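import Literature.Analysis.FluidPDE.HolderHalfDirectionCriterion
import HarnessLib

/-!
# CriticalCoherenceDoorDefs — door S33 «CriticalCoherenceDoor» (vorticity-direction / geometric-depletion door,
# TYPE-II-INCLUSIVE): texts of record + the kernel-checked compositions (plate P0)

Texts of record: nsreg-p1 g27 `r31/Sketch33.lean` sha16 ae52fe0f17f630b4 (ROUND-31 0e10cc668a4f44b3, PLATE-AID-33
ac753e4a397d9491; farm rc 0 / 0 warn / 0 sorry), §0–§4 landed VERBATIM — every declaration below is the sketch's,
unchanged — by nsreg-C26-p1 g5 on LEAD ns-s30-p1 g2's word 13:14:22Z (S-door lane),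
`--supports stmt-NavierStokesRegularity-0056 --as helper`.  The open statements are `def … : Prop` texts (no proof
placeholders); the plates T33 `TwoThresholdStretching`, G33 `PowerGronwallSlab`, A33 `EnstrophyPowerBoundAssembly`,
P2 `SubcriticalEnstrophyContinuation` and the closers land in their own `Theorems/CriticalCoherenceDoor*.lean` files,
BY NAME against the Prop names of this file.
WHAT THIS IS NOT: a regularity CRITERION (a ½-Hölder-coherent scale-critical intense set ⇒ continuation past `T`
in the tree's Sobolev class) about HYPOTHETICAL blow-up; item 0056 `NoTypeII` and NS regularity are NOT proved;
nothing here is a route or a summit statement; no Literature fact is taken as a hypothesis.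

## The sketch's own header (nsreg-p1 g26/g27), verbatim

S33 «CriticalCoherenceDoor» — texts of record (g26 draft 12:11Z, audited + §4 by nsreg-p1 g27; ROUND-31, 2026-08-28)

Door S33 (purpose (a): vorticity direction / geometric depletion; TYPE-II-INCLUSIVE — no rate
hypothesis anywhere). The Beirão da Veiga–Berselli / Constantin–Fefferman ½-Hölder coherence
hypothesis `√(1 − ⟪ξ(x,t), ξ(y,t)⟫²) ≤ M |x − y|^{1/2}` is demanded ONLY for pairs `(x, y)` with
`x` in the SCALE-CRITICAL INTENSE SET `{(T − t)|ω(x,t)| > ε₀}` (and `y` in the classical fixed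
region `{|ω(y,t)| > Ω}`), for a UNIVERSAL `ε₀ < √3/4`; conclusion: continuation past `T` in the
tree's Sobolev class. The sub-critical set `{|ω(x,t)| ≤ ε₀/(T − t)}` — where every direction
hypothesis of print (CF93, BdVB02, GR04, LR16 Thm. 11.7: all on `{|ω| > Ω}` with `Ω` FIXED) still
constrains the direction field — is left completely free.

Lean frame = the PROVED tree theorem `Literature.Analysis.FluidPDE.holderHalf_direction_criterion_of_late`
(HolderHalfDirectionCriterion.lean:293) with ONE token changed in the hypothesis
(`Ω < ‖curl (u t) x‖` ↦ `ε₀ < (T - t) * ‖curl (u t) x‖`) and the constraint `ε₀ < √3/4` added.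

Plates (solution level): `EnstrophyPowerBound` (P1, the content: enstrophy grows at most like
`(T − t)^{−a}` with `a < 1/2`), `SubcriticalEnstrophyContinuation` (P2: such a sub-Leray power bound
continues the solution — restart-and-glue with Tao's `H¹` lifespan at a time `s` where
`(T − s)(A(s)² + 1)` is small, possible iff `2a < 1`; alternatives: Serrin `L⁴_t L⁶_x` via the tree's
`serrin_enstrophy_bound`, or Leray's rate `leray_blowup_rate_enstrophy`); finer plates: `TwoThresholdStretching` (T33, fixed time: the tree's
`exists_two_mul_integral_stretching_le_of_holderHalf` with two thresholds, constants INDEPENDENT of the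
`x`-threshold, low-`x` coefficient `(2/√3)(1+η)Ωₓ` by Chae's strain algebra
`two_mul_inner_curl_fderiv_le_of_divergence_eq_zero`), `PowerGronwallSlab` (G33: the tree's
`integral_sq_norm_curl_le_of_direction_slab` with the extra coefficient `a/(T − t)`), and the glue
`EnstrophyPowerBoundAssembly` (A33). Kernel-checked here: `criticalCoherenceDoor_of : P1 → P2 → door`.
HONEST FRAME: a regularity CRITERION (coherent critical set ⇒ no blow-up); NS regularity / 0056 NOT
claimed; every plate is print-routine mathematics NOT in print as stated (see ROUND-31 §6).

§4 (nsreg-p1 g27, adoption audit 2026-08-28): the BALANCE form `CriticalBalanceDoor` — ONE dimensionally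
meaningful quantity, no `ε₀`, no `√3/4`: if `(T − t)|ω(x,t)| · |ξ(x,t) ∧ ξ(y,t)| ≤ K |x − y|^{1/2}` for all
late `t`, all `x`, and all `y` with `|ω(y,t)| > Ω`, then no blow-up at `T` — with the kernel-checked reduction
`criticalBalanceDoor_of : CriticalCoherenceDoor → CriticalBalanceDoor` (`ε₀ := √3/8`, `M := 8K/√3`).
g27 audit of g26's texts: (i) Chae constant: `λ_max(S) ≤ √(2/3)|S|_F` (trace-free), `|A|²_F = |ω|²/2`,
`2⟪ω,Sω⟫ ≤ (4/√3)|S|_F|A|_F|ω| ≤ (2/√3)|ω| |∇v|²_F` ✓, so `a = (2/√3)(1+η)ε₀ < 1/2 ⇔ (1+η)ε₀ < √3/4` ✓;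
(ii) `TwoThresholdStretching`: every constant is `Ωₓ`-free — the `x`-cutoff is differentiated only in the
`U`-term, where `|∇θₓ| ≤ c/(ηΩₓ)` meets `|ω| ≤ (1+η)Ωₓ` on the layer ✓; the `U`-sup bound and the depletion
see only the `y`-threshold `Ω` ✓; (iii) `SubcriticalEnstrophyContinuation`: restart-and-glue at a time `s`
with `(T − s)(Ē + K(T − s)^{−a})² < cν³` (possible iff `2a < 1`) — the proof of
`hasSobolevExtensionPast_of_uniform_H1_bound` with the restart time moved, no Serrin class needed ✓;
(iv) frame = `holderHalf_direction_criterion_of_late` binder for binder ✓ (farm rc 0, 0 sorry).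
-/

noncomputable section

open MeasureTheory Set Function Filter Metric Real InnerProductSpace
open _root_.Topology
open scoped ENNReal NNReal RealInnerProductSpace ContDiff
open Literature.Analysis.FluidPDE

set_option linter.dupNamespace false

namespace Summit.NavierStokesRegularity.NavierStokesRegularity.Theorems.CriticalCoherenceDoor

-- nested operator types (second derivatives)
set_option maxSynthPendingDepth 3

/-! ## §0 The hypothesis -/

/-- support (definition): the TWO-THRESHOLD ½-Hölder coherence hypothesis on `[t₀, T)`: for every
`t ∈ [t₀, T)` and all `x, y` with `(T − t)|ω(x,t)| > ε₀` (scale-critical intense set) and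
`|ω(y,t)| > Ω` (fixed classical threshold), `|sin ∠(ξ(x,t), ξ(y,t))| ≤ M |x − y|^{1/2}`
(`ξ = ω/|ω|`, `ω = curl u`; `√(1 − ⟪ξ(x), ξ(y)⟫²) = |ξ(x) ∧ ξ(y)|`). -/
def CriticalCoherence (u : ℝ → (EuclideanSpace ℝ (Fin 3)) → (EuclideanSpace ℝ (Fin 3)))
    (T t₀ ε₀ Ω M : ℝ) : Prop :=
  ∀ t ∈ Ico t₀ T, ∀ x y : EuclideanSpace ℝ (Fin 3),
    ε₀ < (T - t) * ‖curl (u t) x‖ → Ω < ‖curl (u t) y‖ →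
      Real.sqrt (1 - ⟪vorticityDirection (curl (u t)) x, vorticityDirection (curl (u t)) y⟫ ^ 2) ≤
        M * Real.sqrt ‖x - y‖

/-! ## §1 The door -/

/-- door S33 «CriticalCoherenceDoor» (regularity criterion; Type-II-inclusive). Let `ν > 0`,
`0 ≤ t₀ < T`, `0 < ε₀ < √3/4`, `Ω > 0`, `M` real, and let `(u, p)` be a classical unforced
Navier–Stokes solution on `ℝ³ × [0, T)` with all `L²` Sobolev seminorms bounded on every `[0, T'']`,
`T'' < T` (the frame of `holderHalf_direction_criterion_of_late`). If `CriticalCoherence u T t₀ ε₀ Ω M`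
holds, then `u` continues in the Sobolev class past `T`. The sub-case "intense set empty"
(`(T − t)‖ω(t)‖_∞ ≤ ε₀`) is the enstrophy floor `(2/√3)·ε₀ < 1/2` versus Leray's rate (tree:
`two_mul_integral_stretching_le_sharp_of_norm_curl_le`, `leray_blowup_rate_enstrophy`); the content of
the door is that a NON-EMPTY but ½-Hölder-coherent intense set costs nothing more. -/
def CriticalCoherenceDoor : Prop :=
  ∀ (ν T t₀ ε₀ Ω M : ℝ), 0 < ν → 0 ≤ t₀ → t₀ < T → 0 < ε₀ → ε₀ < Real.sqrt 3 / 4 → 0 < Ω →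
    ∀ (u : ℝ → (EuclideanSpace ℝ (Fin 3)) → (EuclideanSpace ℝ (Fin 3)))
      (p : ℝ → (EuclideanSpace ℝ (Fin 3)) → ℝ),
      IsClassicalNSSolutionOn (Ico 0 T) ν 0 u p →
      (∀ T'' < T, HasBoundedSobolevNormsOn (Icc 0 T'') u) →
      CriticalCoherence u T t₀ ε₀ Ω M →
      HasSobolevExtensionPast ν u T

/-! ## §2 Solution-level plates -/

/-- plate P1 «EnstrophyPowerBound» (M/L; the content). In the frame of the door, the Dirichlet
integral grows at most like a SUB-LERAY power: there are `K ≥ 0` and `a < 1/2` with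
`∫|∇u(t)|²_F ≤ K (T − t)^{−a}` for all `t ∈ [t₀, T)`. Print proof: `TwoThresholdStretching` at the
moving threshold `Ωₓ = ε₀/(T − t)` + `PowerGronwallSlab` with `a = (2/√3)(1+η)ε₀ < 1/2`
(`η > 0` small, possible iff `ε₀ < √3/4`) on every slab `[t₀, T'']` of the time-translated solution,
Tao's energy class for `Ē, I` (verbatim the bookkeeping of
`exists_uniform_H1_bound_of_holderHalf_direction`) — see `EnstrophyPowerBoundAssembly`. -/
def EnstrophyPowerBound : Prop :=
  ∀ (ν T t₀ ε₀ Ω M : ℝ), 0 < ν → 0 ≤ t₀ → t₀ < T → 0 < ε₀ → ε₀ < Real.sqrt 3 / 4 → 0 < Ω →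
    ∀ (u : ℝ → (EuclideanSpace ℝ (Fin 3)) → (EuclideanSpace ℝ (Fin 3)))
      (p : ℝ → (EuclideanSpace ℝ (Fin 3)) → ℝ),
      IsClassicalNSSolutionOn (Ico 0 T) ν 0 u p →
      (∀ T'' < T, HasBoundedSobolevNormsOn (Icc 0 T'') u) →
      CriticalCoherence u T t₀ ε₀ Ω M →
      ∃ K a : ℝ, 0 ≤ K ∧ a < 1 / 2 ∧ ∀ t ∈ Ico t₀ T,
        (∫⁻ x, ENNReal.ofReal (frobeniusNormSq (fderiv ℝ (u t) x))) ≤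
          ENNReal.ofReal (K * (T - t) ^ (-a))

/-- plate P2 «SubcriticalEnstrophyContinuation» (S/M; no direction hypothesis; Leray's 1934 rate in the
tree's Sobolev-class frame). A classical solution on `[0, T)` in the frame whose Dirichlet integral obeys
`∫|∇u(t)|²_F ≤ K (T − t)^{−a}` on `[t₀, T)` with `a < 1/2` continues past `T`. Proof (restart-and-glue =
the proof of `hasSobolevExtensionPast_of_uniform_H1_bound`, H1ContinuationSobolevClass.lean:64–121, with the
restart time moved): energy `‖u(t)‖₂² ≤ Ē` on `[0, T)` (`tao_finite_energy_smooth_energy_bound_holds`);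
Tao's `H¹` local existence `tao2011_smooth_local_existence_holds` from the slice `u(s)` lives for
`τ(s) = cν³/(A(s)² + 1)`, `A(s) = Ē + K(T − s)^{−a}`; since `(T − s)·(A(s)² + 1) → 0` as `s ↑ T`
(`2a < 1`), some `s ∈ [t₀, T)` has `τ(s) > T − s`; uniqueness in the class
(`MajdaBertozzi2002_uniquenessSobolev_holds`) and `HasSobolevExtensionPast.of_translate` glue.
Alternative: Serrin `L⁴_t L⁶_x` (`∫‖u‖₆⁴ ≤ C_S² K² ∫(T − t)^{−2a} < ∞`) via `serrin_enstrophy_bound`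
(`r = 6`; needs the time-derivative / pressure seminorm bounds of Tao's class). (`K < 0` makes the
hypothesis say `∇u ≡ 0` on `[t₀, T)`: still fine.) -/
def SubcriticalEnstrophyContinuation : Prop :=
  ∀ (ν T t₀ K a : ℝ), 0 < ν → 0 ≤ t₀ → t₀ < T → a < 1 / 2 →
    ∀ (u : ℝ → (EuclideanSpace ℝ (Fin 3)) → (EuclideanSpace ℝ (Fin 3)))
      (p : ℝ → (EuclideanSpace ℝ (Fin 3)) → ℝ),
      IsClassicalNSSolutionOn (Ico 0 T) ν 0 u p →
      (∀ T'' < T, HasBoundedSobolevNormsOn (Icc 0 T'') u) →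
      (∀ t ∈ Ico t₀ T,
        (∫⁻ x, ENNReal.ofReal (frobeniusNormSq (fderiv ℝ (u t) x))) ≤
          ENNReal.ofReal (K * (T - t) ^ (-a))) →
      HasSobolevExtensionPast ν u T

/-- composition (kernel-checked): P1 and P2 give the door. -/
theorem criticalCoherenceDoor_of (h₁ : EnstrophyPowerBound) (h₂ : SubcriticalEnstrophyContinuation) :
    CriticalCoherenceDoor := by
  intro ν T t₀ ε₀ Ω M hν ht₀ ht₀T hε₀ hε₁ hΩ u p hsol hreg hcoh
  obtain ⟨K, a, -, ha, hF⟩ := h₁ ν T t₀ ε₀ Ω M hν ht₀ ht₀T hε₀ hε₁ hΩ u p hsol hreg hcoh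
  exact h₂ ν T t₀ K a hν ht₀ ht₀T ha u p hsol hreg hF

/-! ## §3 Finer plates (the print proof of P1) -/

/-- plate T33 «TwoThresholdStretching» (M; fixed time; the one genuinely new estimate). For
`ν, Ω, η > 0` and real `Mh` there are `C₁, …, C₄ ≥ 0` — chosen BEFORE the `x`-threshold — such that
for every `Ωₓ > 0` and every admissible field `v` (as in
`exists_two_mul_integral_stretching_le_of_holderHalf`) whose vorticity directions satisfy the pair
hypothesis for `|ω(x)| > Ωₓ`, `|ω(y)| > Ω`:
`2∫⟪ω,(∇v)ω⟫ ≤ ν∫|∇ω|²_F + ((2/√3)(1+η)Ωₓ + C₁ + C₂∫|ω|² + C₃∫|v|²)∫|ω|² + C₄∫|∇v|²_F`.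
Print proof (NOT the tree's `Et/Bt/Gt` split, whose crude low bound `|Et| ≤ 2R(|∇v|² + |ω|²)` would
give `8(1+η)Ωₓ`): weight the WHOLE density by the smooth value-cutoff `θₓ = radialCutoff Ωₓ ((1+η)Ωₓ) (ω x)`
and its complement. LOW-`x` (`θₓ`-weighted; `|ω(x)| ≤ (1+η)Ωₓ` on `supp θₓ`): pointwise Chae bound
`2⟪ω,(∇v)ω⟫ ≤ (2/√3)(1+η)Ωₓ |∇v|²_F` (`two_mul_inner_curl_fderiv_le_of_divergence_eq_zero`; `θₓ ≤ 1`,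
right side `≥ 0`) and `∫|∇v|²_F ≤ ∫|ω|²` (`lintegral_frobeniusNormSq_fderiv_le_lintegral_sq_norm_curl`).
HIGH-`x` × LOW-`y` (`U = v − K ∗ ω_hi`, `ω_hi = (1 − radialCutoff R (2R)(ω y)) ω y` as in the tree,
`R = Ω`): integration by parts against `((1 − θₓ) ω) ⊗ ω` (`div ω = 0`;
`|∇((1 − θₓ(ω))ω)| ≤ (1 + B_θ(1+η)/η)|∇ω|` because `|∇θₓ| ≤ B_θ/(ηΩₓ)`
(`exists_norm_fderiv_radialCutoff_le`) meets `|ω| ≤ (1+η)Ωₓ` on the layer) with the sup bound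
`‖U‖_∞ ≤ 4R + C_b‖ω‖₂ + C_v‖v‖₂` (`exists_norm_sub_biotSavart_le`) ⇒
`(ν/3)∫|∇ω|²_F + C(η,Ω,ν)(1 + ∫|ω|² + ∫|v|²)∫|ω|²`. HIGH-`x` × HIGH-`y`: geometric depletion
`exists_abs_inner_fderiv_biotSavart_le` with `e = ξ(x)` for the pairs `|ω(x)| > Ωₓ`, `|ω(y)| > Ω`
(two-threshold copy of `exists_abs_inner_highPart_fderiv_biotSavart_le_holder`: weight `(1 − θₓ)|ω(x)|²` at
`x`, density `|ω_hi(y)|` at `y`) + `lintegral_mul_rieszHalfPotential_le_two_radii` + Ladyzhenskaya + Young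
exactly as in the tree. No constant sees `Ωₓ` except the displayed low-`x` coefficient (checked term by
term by g27); in particular the estimate holds for EVERY `Ωₓ > 0`, also `Ωₓ < Ω`. -/
def TwoThresholdStretching : Prop :=
  ∀ (ν Ω Mh η : ℝ), 0 < ν → 0 < Ω → 0 < η →
    ∃ C₁ C₂ C₃ C₄ : ℝ, 0 ≤ C₁ ∧ 0 ≤ C₂ ∧ 0 ≤ C₃ ∧ 0 ≤ C₄ ∧
      ∀ (Ωx : ℝ), 0 < Ωx →
      ∀ ⦃v : (EuclideanSpace ℝ (Fin 3)) → (EuclideanSpace ℝ (Fin 3))⦄ (_ : ContDiff ℝ 2 v)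
        (_ : VectorCalculus.IsDivFree v)
        (_ : Integrable fun x => ‖v x‖ ^ 2) (_ : Integrable fun x => ‖fderiv ℝ v x‖ ^ 2)
        (_ : Integrable fun x => ‖fderiv ℝ (fderiv ℝ v) x‖ ^ 2)
        (_ : ∃ B : ℝ, ∀ x, ‖fderiv ℝ (fderiv ℝ v) x‖ ≤ B)
        (_ : ∀ x y, Ωx < ‖curl v x‖ → Ω < ‖curl v y‖ →
          Real.sqrt (1 - ⟪vorticityDirection (curl v) x, vorticityDirection (curl v) y⟫ ^ 2) ≤
            Mh * Real.sqrt ‖x - y‖),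
        2 * ∫ x, ⟪curl v x, fderiv ℝ v x (curl v x)⟫ ≤
          ν * (∫ x, frobeniusNormSq (fderiv ℝ (curl v) x)) +
            (2 / Real.sqrt 3 * (1 + η) * Ωx + C₁ + C₂ * (∫ x, ‖curl v x‖ ^ 2) +
                C₃ * (∫ x, ‖v x‖ ^ 2)) * (∫ x, ‖curl v x‖ ^ 2) +
            C₄ * (∫ x, frobeniusNormSq (fderiv ℝ v x))

/-- plate G33 «PowerGronwallSlab» (S/M; the Grönwall step with one singular-but-subcritical
coefficient). On a closed slab `[0, T''] × ℝ³`, `T'' < T`, in the frame of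
`integral_sq_norm_curl_le_of_direction_slab` (energy `≤ Ē`, dissipation `≤ I`), a stretching
inequality with coefficient `a/(T − t) + C₁ + C₂∫|ω|² + C₃∫|u|²` (`a ≥ 0`) yields
`∫|ω(t)|² ≤ (∫|ω(0)|² + C₄ I) (T/(T − t))^a exp((C₁ + C₃Ē)T'' + C₂‖curl‖²I)` on `[0, T'']`
(`∫₀ᵗ a/(T − s) ds = a log (T/(T − t))`). Proof: the tree's slab Grönwall verbatim with the extra
integrating factor. -/
def PowerGronwallSlab : Prop :=
  ∀ (ν T T'' a : ℝ), 0 < ν → 0 < T'' → T'' < T → 0 ≤ a →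
    ∀ (u : ℝ → (EuclideanSpace ℝ (Fin 3)) → (EuclideanSpace ℝ (Fin 3)))
      (p : ℝ → (EuclideanSpace ℝ (Fin 3)) → ℝ),
      IsClassicalNSSolutionOn (Icc 0 T'') ν 0 u p → HasBoundedSobolevNormsOn (Icc 0 T'') u →
      ∀ (Ē I : ℝ), 0 ≤ Ē → 0 ≤ I →
      (∀ t ∈ Icc 0 T'', ∫⁻ x, ‖u t x‖ₑ ^ 2 ≤ ENNReal.ofReal Ē) →
      (∫⁻ t in Ioo 0 T'', ∫⁻ x, ENNReal.ofReal (frobeniusNormSq (fderiv ℝ (u t) x)) ≤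
        ENNReal.ofReal I) →
      ∀ (C₁ C₂ C₃ C₄ : ℝ), 0 ≤ C₁ → 0 ≤ C₂ → 0 ≤ C₃ → 0 ≤ C₄ →
      (∀ t ∈ Icc 0 T'',
        2 * ∫ x, ⟪curl (u t) x, fderiv ℝ (u t) x (curl (u t) x)⟫ ≤
          ν * (∫ x, frobeniusNormSq (fderiv ℝ (curl (u t)) x)) +
            (a / (T - t) + C₁ + C₂ * (∫ x, ‖curl (u t) x‖ ^ 2) + C₃ * (∫ x, ‖u t x‖ ^ 2)) *
              (∫ x, ‖curl (u t) x‖ ^ 2) +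
            C₄ * (∫ x, frobeniusNormSq (fderiv ℝ (u t) x))) →
      ∀ t ∈ Icc 0 T'', ∫ x, ‖curl (u t) x‖ ^ 2 ≤
        ((∫ x, ‖curl (u 0) x‖ ^ 2) + C₄ * I) * (T / (T - t)) ^ a *
          Real.exp ((C₁ + C₃ * Ē) * T'' + C₂ * (‖curlCLM‖ ^ 2 * I))

/-- plate A33 «EnstrophyPowerBoundAssembly» (M, glue; no new idea). T33 + G33 ⇒ P1: translate time by
`t₀` (`HasSobolevExtensionPast.of_translate`-style bookkeeping is NOT needed here — only the classical
class and the Sobolev bounds of `u (· + t₀)` on `[0, T − t₀)`), take `Ē, I` from Tao's energy class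
(`tao_finite_energy_smooth_energy_bound_holds`), pick `η := (√3/(4ε₀) − 1)/2 > 0` so that
`a := (2/√3)(1+η)ε₀ < 1/2`, apply T33 at each `t` with `Ωₓ := ε₀/(T − t)` and G33 on every slab
`[0, T'' − t₀]`, and read off `K` independent of `T''`; finally `∫|∇u|²_F ≤ ∫|ω|²`
(`lintegral_frobeniusNormSq_fderiv_le_lintegral_sq_norm_curl`). Body = lines 95–215 of
HolderHalfDirectionCriterion.lean with these substitutions. -/
def EnstrophyPowerBoundAssembly : Prop :=
  TwoThresholdStretching → PowerGronwallSlab → EnstrophyPowerBound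

/-- composition (kernel-checked): the four finer plates and P2 give the door. -/
theorem criticalCoherenceDoor_of_plates (hT : TwoThresholdStretching) (hG : PowerGronwallSlab)
    (hA : EnstrophyPowerBoundAssembly) (h₂ : SubcriticalEnstrophyContinuation) :
    CriticalCoherenceDoor :=
  criticalCoherenceDoor_of (hA hT hG) h₂

/-! ## §4 The balance form (corollary; no threshold constant) -/

/-- support (definition): the CRITICAL BALANCE hypothesis on `[t₀, T)` with constant `K`: for every
`t ∈ [t₀, T)`, every `x`, and every `y` with `|ω(y,t)| > Ω`,
`(T − t)|ω(x,t)| · |ξ(x,t) ∧ ξ(y,t)| ≤ K |x − y|^{1/2}` — the scale-weighted ½-Hölder quotient of the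
direction field is bounded (vacuous where `ω(x,t) = 0`; no constraint is hidden in a threshold). -/
def CriticalBalance (u : ℝ → (EuclideanSpace ℝ (Fin 3)) → (EuclideanSpace ℝ (Fin 3)))
    (T t₀ Ω K : ℝ) : Prop :=
  ∀ t ∈ Ico t₀ T, ∀ x y : EuclideanSpace ℝ (Fin 3), Ω < ‖curl (u t) y‖ →
    (T - t) * ‖curl (u t) x‖ *
        Real.sqrt (1 - ⟪vorticityDirection (curl (u t)) x, vorticityDirection (curl (u t)) y⟫ ^ 2) ≤
      K * Real.sqrt ‖x - y‖

/-- door S33-B «CriticalBalanceDoor» (corollary of S33; the headline without constants). In the frame of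
`CriticalCoherenceDoor`: if `CriticalBalance u T t₀ Ω K` holds for some `t₀ < T`, `Ω > 0`, `K` real, then
`u` continues in the Sobolev class past `T`. -/
def CriticalBalanceDoor : Prop :=
  ∀ (ν T t₀ Ω K : ℝ), 0 < ν → 0 ≤ t₀ → t₀ < T → 0 < Ω →
    ∀ (u : ℝ → (EuclideanSpace ℝ (Fin 3)) → (EuclideanSpace ℝ (Fin 3)))
      (p : ℝ → (EuclideanSpace ℝ (Fin 3)) → ℝ),
      IsClassicalNSSolutionOn (Ico 0 T) ν 0 u p →
      (∀ T'' < T, HasBoundedSobolevNormsOn (Icc 0 T'') u) →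
      CriticalBalance u T t₀ Ω K →
      HasSobolevExtensionPast ν u T

/-- reduction (kernel-checked): balance with constant `K` is coherence at `ε₀ := √3/8 < √3/4` with
`M := K/ε₀` on the intense set `{(T − t)|ω(x,t)| > ε₀}`. -/
theorem criticalBalanceDoor_of (h : CriticalCoherenceDoor) : CriticalBalanceDoor := by
  intro ν T t₀ Ω K hν ht₀ ht₀T hΩ u p hsol hreg hbal
  have h3 : 0 < Real.sqrt 3 := Real.sqrt_pos.2 (by norm_num)
  have hε : (0 : ℝ) < Real.sqrt 3 / 8 := by positivity
  have hε' : Real.sqrt 3 / 8 < Real.sqrt 3 / 4 := by linarith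
  refine h ν T t₀ (Real.sqrt 3 / 8) Ω (K / (Real.sqrt 3 / 8)) hν ht₀ ht₀T hε hε' hΩ u p hsol hreg ?_
  intro t ht x y hx hy
  have hq := hbal t ht x y hy
  have hqpos : 0 < (T - t) * ‖curl (u t) x‖ := hε.trans hx
  have hs0 : 0 ≤ Real.sqrt (1 - ⟪vorticityDirection (curl (u t)) x,
      vorticityDirection (curl (u t)) y⟫ ^ 2) := Real.sqrt_nonneg _
  have hKr : 0 ≤ K * Real.sqrt ‖x - y‖ :=
    le_trans (mul_nonneg hqpos.le hs0) hq
  calc Real.sqrt (1 - ⟪vorticityDirection (curl (u t)) x, vorticityDirection (curl (u t)) y⟫ ^ 2)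
      ≤ K * Real.sqrt ‖x - y‖ / ((T - t) * ‖curl (u t) x‖) := by
        rw [le_div_iff₀ hqpos]
        calc Real.sqrt (1 - ⟪vorticityDirection (curl (u t)) x,
              vorticityDirection (curl (u t)) y⟫ ^ 2) * ((T - t) * ‖curl (u t) x‖)
            = (T - t) * ‖curl (u t) x‖ * Real.sqrt (1 - ⟪vorticityDirection (curl (u t)) x,
              vorticityDirection (curl (u t)) y⟫ ^ 2) := by ring
          _ ≤ K * Real.sqrt ‖x - y‖ := hq
    _ ≤ K * Real.sqrt ‖x - y‖ / (Real.sqrt 3 / 8) := div_le_div_of_nonneg_left hKr hε hx.le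
    _ = K / (Real.sqrt 3 / 8) * Real.sqrt ‖x - y‖ := by ring

end Summit.NavierStokesRegularity.NavierStokesRegularity.Theorems.CriticalCoherenceDoor

end
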